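import Mathlib.RingTheory.Valuation.ValuationSubring
import Mathlib.RingTheory.LocalRing.ResidueField.Basic
import Mathlib.FieldTheory.IntermediateField.Basic
import Mathlib.LinearAlgebra.Dimension.Finite
import Mathlib.GroupTheory.Index
import HarnessLib

/-!
# The fundamental inequality `e·f ≤ n` for a finite extension of valued fields

Topic: `Literature/AlgebraicGeometry/Resolution` (valued function fields). A PROVED classical
ingredient of M. Temkin, *Inseparable local uniformization*, J. Algebra 373 (2013) 65–119 =
arXiv:0804.1554v3, §2.1 (p. 9: "By extension `l/k` of valued fields we mean an inclusion
`k ↪ l` which respects the valuations in the sense that `l° ∩ k = k°`. If `n = [l : k]` is finite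
then it is standard to introduce the numbers `e = e_{l/k} = #|l^×|/|k^×|` and
`f = f_{l/k} = [l̃ : k̃]`, and the extension is called immediate if `ef = 1` … An easy classical
result states that `ef ≤ n`"), on which the notions "defect", "defectless", "stable" of
loc. cit. — and hence Remark 2.1.3 and §5.4–5.5 of the source (the stability theorem) — rest.

Rendering: the larger valued field is `K` with valuation ring `O = K°` (a `ValuationSubring`),
the smaller one is a subfield `F ⊆ K` with the induced valuation ring `F ∩ K°` (so that
"`l° ∩ k = k°`" holds by construction); `|F^×| ⊆ |K^×|` is replaced by any subgroup `H` of the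
value group `(ValueGroup O)ˣ` containing the values of `F^×`, and `F̃ ⊆ K̃` by any subfield `L`
of the residue field containing the residues of `F ∩ K°` (for the smallest such `H`, `L` one
recovers `e = [|K^×| : |F^×|]` as `H.index` and `f = [K̃ : F̃]` as `finrank L K̃`).

## Content (everything PROVED)

* `linearIndependent_mul_of_valuation_of_residue` — the heart of `ef ≤ n`: products `aᵢ bⱼ` of
  elements `aᵢ` with values in distinct cosets modulo `H` and elements `bⱼ ∈ K°` with
  `L`-linearly independent residues are `F`-linearly independent.
* `mul_le_finrank_of_valuation_of_residue` — hence `e·f ≤ [K : F]` for such families;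
  `index_mul_finrank_le_finrank` — `H` has finite index, `K̃` is finite over `L`, and
  `[|K^×| : H] · [K̃ : L] ≤ [K : F]`.

## Sources

* M. Temkin, *Inseparable local uniformization*, J. Algebra 373 (2013) = arXiv:0804.1554v3,
  §2.1 (p. 9).
* (Classical: e.g. O. Zariski, P. Samuel, *Commutative Algebra* II, Ch. VI §11; H. Knaf,
  F.-V. Kuhlmann, Ann. Sci. ENS 38 (2005), (2) p. 6.)
-/

noncomputable section

namespace Literature.AlgebraicGeometry.Resolution

open IsLocalRing

universe u

variable {K : Type u} [Field K] (O : ValuationSubring K)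

/-- **The fundamental inequality `ef ≤ n`, linear-independence form** (classical; Temkin 2013,
§2.1, p. 9: "If `n = [l : k]` is finite then it is standard to introduce the numbers
`e = e_{l/k} = #|l^×|/|k^×|` and `f = f_{l/k} = [l̃ : k̃]` … An easy classical result states that
`ef ≤ n`"). Let `F ⊆ K` be a subfield, `H` a subgroup of the value group of `K` containing the
values of `F^×`, and `L` a subfield of the residue field `K̃` containing the residues of `F ∩ K°`.
If `a₁, …, a_e ∈ K^×` have values in pairwise distinct cosets modulo `H` and `b₁, …, b_f ∈ K°`
have `L`-linearly independent residues, then the `e·f` products `aᵢbⱼ` are linearly independent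
over `F`. PROVED (for a non-trivial relation `∑ cᵢⱼ aᵢ bⱼ = 0`, each non-zero row sum
`∑ⱼ cᵢⱼ bⱼ` has the value of its largest coefficient — normalise and reduce, using the
independence of the `b̄ⱼ` — so the non-zero terms `aᵢ ∑ⱼ cᵢⱼ bⱼ` have values in distinct cosets,
hence pairwise distinct values, contradicting the ultrametric inequality).
[cite: Temkin2013, Section 2.1 (p. 9 of arXiv:0804.1554v3)] -/
theorem linearIndependent_mul_of_valuation_of_residue (F : Subfield K)
    (H : Subgroup (ValuationSubring.ValueGroup O)ˣ)
    (hH : ∀ c : K, c ∈ F → (hc : c ≠ 0) →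
      Units.mk0 (O.valuation c) ((Valuation.ne_zero_iff _).mpr hc) ∈ H)
    (L : Subfield (ResidueField O))
    (hL : ∀ c : K, c ∈ F → (hc : c ∈ O) → residue O ⟨c, hc⟩ ∈ L)
    {e f : ℕ} (a : Fin e → K) (ha0 : ∀ i, a i ≠ 0)
    (hdist : ∀ i i', i ≠ i' →
      (Units.mk0 (O.valuation (a i)) ((Valuation.ne_zero_iff _).mpr (ha0 i)))⁻¹ *
        Units.mk0 (O.valuation (a i')) ((Valuation.ne_zero_iff _).mpr (ha0 i')) ∉ H)
    (b : Fin f → O) (hb : LinearIndependent L fun j => residue O (b j)) :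
    LinearIndependent F fun p : Fin e × Fin f => a p.1 * (b p.2 : K) := by
  classical
  rw [Fintype.linearIndependent_iff]
  intro g hsum
  by_contra hne
  push Not at hne
  obtain ⟨⟨i₁, j₁⟩, hg₁⟩ := hne
  -- row sums
  let S : Fin e → K := fun i => ∑ j, ((g (i, j) : F) : K) * (b j : K)
  have hsumS : ∑ i, a i * S i = 0 := by
    have h1 : ∑ i, a i * S i = ∑ p : Fin e × Fin f, ((g p : F) : K) * (a p.1 * (b p.2 : K)) := by
      rw [Fintype.sum_prod_type]
      refine Finset.sum_congr rfl fun i _ => ?_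
      rw [Finset.mul_sum]
      exact Finset.sum_congr rfl fun j _ => by ring
    rw [h1, ← hsum]
    exact Finset.sum_congr rfl fun p _ => rfl
  -- the value of a non-zero row sum is the value of its largest coefficient
  have hrow : ∀ i, (∃ j, g (i, j) ≠ 0) →
      ∃ j₀, ((g (i, j₀) : F) : K) ≠ 0 ∧ O.valuation (S i) = O.valuation ((g (i, j₀) : F) : K) := by
    rintro i ⟨j, hj⟩
    obtain ⟨j₀, -, hmax⟩ :=
      Finset.univ.exists_max_image (fun j => O.valuation ((g (i, j) : F) : K)) ⟨j, Finset.mem_univ _⟩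
    have hc0 : ((g (i, j₀) : F) : K) ≠ 0 := by
      intro h0
      have h1 : O.valuation ((g (i, j) : F) : K) ≤ O.valuation ((g (i, j₀) : F) : K) :=
        hmax j (Finset.mem_univ _)
      rw [h0, map_zero, le_zero_iff, map_eq_zero] at h1
      exact hj (by exact_mod_cast h1)
    have hvc0 : O.valuation ((g (i, j₀) : F) : K) ≠ 0 := (Valuation.ne_zero_iff _).mpr hc0
    refine ⟨j₀, hc0, ?_⟩
    -- normalised coefficients lie in `K°`
    have hgO : ∀ j', ((g (i, j') : F) : K) / ((g (i, j₀) : F) : K) ∈ O := fun j' => by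
      refine (O.valuation_le_one_iff _).mp ?_
      rw [map_div₀]
      exact (div_le_one₀ (zero_lt_iff.mpr hvc0)).mpr (hmax j' (Finset.mem_univ _))
    -- the normalised row sum is a unit of `K°`: its residue is non-zero
    let T : O := ∑ j', (⟨((g (i, j') : F) : K) / ((g (i, j₀) : F) : K), hgO j'⟩ : O) * b j'
    have hT : (T : K) = S i / ((g (i, j₀) : F) : K) := by
      change ((∑ j', (⟨((g (i, j') : F) : K) / ((g (i, j₀) : F) : K), hgO j'⟩ : O) * b j' : O) : K) = _
      rw [AddSubmonoidClass.coe_finsetSum]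
      change ∑ j', ((g (i, j') : F) : K) / ((g (i, j₀) : F) : K) * (b j' : K) = _
      rw [div_eq_mul_inv, Finset.sum_mul]
      exact Finset.sum_congr rfl fun j' _ => by ring
    have hresT : residue O T ≠ 0 := by
      intro h0
      let l : Fin f → L := fun j' => ⟨residue O ⟨((g (i, j') : F) : K) / ((g (i, j₀) : F) : K), hgO j'⟩,
        hL _ (div_mem (g (i, j')).2 (g (i, j₀)).2) (hgO j')⟩
      have hrel : ∑ j', l j' • residue O (b j') = 0 := by
        rw [← h0]
        change _ = residue O (∑ j', _)
        rw [map_sum]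
        refine Finset.sum_congr rfl fun j' _ => ?_
        rw [map_mul]
        rfl
      have hl0 := (Fintype.linearIndependent_iff.mp hb) l hrel j₀
      have hl1 : l j₀ = 1 := Subtype.ext (by
        change residue O ⟨((g (i, j₀) : F) : K) / ((g (i, j₀) : F) : K), _⟩ = 1
        have h1 : (⟨((g (i, j₀) : F) : K) / ((g (i, j₀) : F) : K), hgO j₀⟩ : O) = 1 :=
          Subtype.ext (div_self hc0)
        rw [h1, map_one])
      rw [hl1] at hl0
      exact one_ne_zero hl0
    have hvT : O.valuation (T : K) = 1 := by
      have h1 : T ∉ IsLocalRing.maximalIdeal O := fun hm => hresT ((residue_eq_zero_iff _).mpr hm)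
      by_contra hne1
      exact h1 ((ValuationSubring.valuation_lt_one_iff O T).mpr
        (lt_of_le_of_ne (O.valuation_le_one T) hne1))
    rw [hT, map_div₀, div_eq_one_iff_eq hvc0] at hvT
    exact hvT
  -- the non-zero terms `aᵢ Sᵢ` have values in pairwise distinct cosets, hence distinct values
  let s : Finset (Fin e) := Finset.univ.filter fun i => ∃ j, g (i, j) ≠ 0
  have hi₁ : i₁ ∈ s := Finset.mem_filter.mpr ⟨Finset.mem_univ _, j₁, hg₁⟩
  have hS0 : ∀ i, i ∉ s → S i = 0 := by
    intro i hi
    have h : ∀ j, g (i, j) = 0 := fun j => by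
      by_contra hj
      exact hi (Finset.mem_filter.mpr ⟨Finset.mem_univ _, j, hj⟩)
    simp only [S, h, ZeroMemClass.coe_zero, zero_mul, Finset.sum_const_zero]
  have hsum_s : ∑ i ∈ s, a i * S i = 0 := by
    rw [← hsumS, ← Finset.sum_filter_add_sum_filter_not Finset.univ (fun i => ∃ j, g (i, j) ≠ 0)]
    rw [Finset.sum_eq_zero (s := Finset.univ.filter fun i => ¬∃ j, g (i, j) ≠ 0) (fun i hi => by
      rw [hS0 i (fun hi' => (Finset.mem_filter.mp hi).2 (Finset.mem_filter.mp hi').2), mul_zero]),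
      add_zero]
  choose j₀ hj₀c hj₀v using fun i : ↥s => hrow i (Finset.mem_filter.mp i.2).2
  obtain ⟨i₀, hi₀, hmax⟩ := s.exists_max_image (fun i => O.valuation (a i * S i)) ⟨i₁, hi₁⟩
  have hne0 : ∀ i ∈ s, a i * S i ≠ 0 := fun i hi => by
    refine mul_ne_zero (ha0 i) fun h0 => ?_
    have := hj₀v ⟨i, hi⟩
    rw [h0, map_zero] at this
    exact (Valuation.ne_zero_iff _).mpr (hj₀c ⟨i, hi⟩) this.symm
  have hlt : ∀ i ∈ s \ {i₀}, O.valuation (a i * S i) < O.valuation (a i₀ * S i₀) := by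
    intro i hi
    obtain ⟨his, hne⟩ := Finset.mem_sdiff.mp hi
    rw [Finset.mem_singleton] at hne
    refine lt_of_le_of_ne (hmax i his) fun heq => hdist i i₀ hne ?_
    -- equal values put `v(aᵢ)⁻¹ v(aᵢ₀)` into `H`
    have hci := hH _ (g (i, j₀ ⟨i, his⟩)).2 (hj₀c ⟨i, his⟩)
    have hci₀ := hH _ (g (i₀, j₀ ⟨i₀, hi₀⟩)).2 (hj₀c ⟨i₀, hi₀⟩)
    have h2 : Units.mk0 (O.valuation (a i)) ((Valuation.ne_zero_iff _).mpr (ha0 i)) *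
        Units.mk0 (O.valuation ((g (i, j₀ ⟨i, his⟩) : F) : K))
          ((Valuation.ne_zero_iff _).mpr (hj₀c ⟨i, his⟩)) =
        Units.mk0 (O.valuation (a i₀)) ((Valuation.ne_zero_iff _).mpr (ha0 i₀)) *
          Units.mk0 (O.valuation ((g (i₀, j₀ ⟨i₀, hi₀⟩) : F) : K))
            ((Valuation.ne_zero_iff _).mpr (hj₀c ⟨i₀, hi₀⟩)) := by
      apply Units.ext
      simp only [Units.val_mul, Units.val_mk0, ← map_mul]
      rw [map_mul, map_mul, ← hj₀v ⟨i, his⟩, ← hj₀v ⟨i₀, hi₀⟩, ← map_mul, ← map_mul]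
      exact heq
    have h3 : (Units.mk0 (O.valuation (a i)) ((Valuation.ne_zero_iff _).mpr (ha0 i)))⁻¹ *
        Units.mk0 (O.valuation (a i₀)) ((Valuation.ne_zero_iff _).mpr (ha0 i₀)) =
        Units.mk0 (O.valuation ((g (i, j₀ ⟨i, his⟩) : F) : K))
            ((Valuation.ne_zero_iff _).mpr (hj₀c ⟨i, his⟩)) *
          (Units.mk0 (O.valuation ((g (i₀, j₀ ⟨i₀, hi₀⟩) : F) : K))
            ((Valuation.ne_zero_iff _).mpr (hj₀c ⟨i₀, hi₀⟩)))⁻¹ := by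
      rw [inv_mul_eq_iff_eq_mul, ← mul_assoc, eq_mul_inv_iff_mul_eq]
      exact h2.symm
    rw [h3]
    exact H.mul_mem hci (H.inv_mem hci₀)
  have hv := O.valuation.map_sum_eq_of_lt hi₀ hlt
  rw [hsum_s, map_zero] at hv
  exact hne0 i₀ hi₀ ((map_eq_zero O.valuation).mp hv.symm)

/-- **The fundamental inequality `ef ≤ n`, counting form**: with `F`, `H`, `L` as above and
`K` finite over `F`, `e` non-zero elements with values in distinct cosets modulo `H` and `f`
elements of `K°` with `L`-linearly independent residues satisfy `e·f ≤ [K : F]`. PROVED.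
[cite: Temkin2013, Section 2.1 (p. 9 of arXiv:0804.1554v3)] -/
theorem mul_le_finrank_of_valuation_of_residue (F : Subfield K) [FiniteDimensional F K]
    (H : Subgroup (ValuationSubring.ValueGroup O)ˣ)
    (hH : ∀ c : K, c ∈ F → (hc : c ≠ 0) →
      Units.mk0 (O.valuation c) ((Valuation.ne_zero_iff _).mpr hc) ∈ H)
    (L : Subfield (ResidueField O))
    (hL : ∀ c : K, c ∈ F → (hc : c ∈ O) → residue O ⟨c, hc⟩ ∈ L)
    {e f : ℕ} (a : Fin e → K) (ha0 : ∀ i, a i ≠ 0)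
    (hdist : ∀ i i', i ≠ i' →
      (Units.mk0 (O.valuation (a i)) ((Valuation.ne_zero_iff _).mpr (ha0 i)))⁻¹ *
        Units.mk0 (O.valuation (a i')) ((Valuation.ne_zero_iff _).mpr (ha0 i')) ∉ H)
    (b : Fin f → O) (hb : LinearIndependent L fun j => residue O (b j)) :
    e * f ≤ Module.finrank F K := by
  have h := (linearIndependent_mul_of_valuation_of_residue O F H hH L hL a ha0 hdist b hb)
    |>.fintype_card_le_finrank
  simpa [Fintype.card_prod, Fintype.card_fin] using h

/-- **The fundamental inequality `ef ≤ n`, index form**: with `F`, `H`, `L` as above and `K`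
finite over `F`, the subgroup `H ⊇ |F^×|` has finite index `e'` in `|K^×|`, the residue field
`K̃` is finite over `L ⊇ (F ∩ K°)~`, of degree `f'`, and `e'·f' ≤ [K : F]`; for `H = |F^×|` and
`L = F̃` these are `e = #(|K^×|/|F^×|)` and `f = [K̃ : F̃]`. PROVED.
[cite: Temkin2013, Section 2.1 (p. 9 of arXiv:0804.1554v3)] -/
theorem index_mul_finrank_le_finrank (F : Subfield K) [FiniteDimensional F K]
    (H : Subgroup (ValuationSubring.ValueGroup O)ˣ)
    (hH : ∀ c : K, c ∈ F → (hc : c ≠ 0) →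
      Units.mk0 (O.valuation c) ((Valuation.ne_zero_iff _).mpr hc) ∈ H)
    (L : Subfield (ResidueField O))
    (hL : ∀ c : K, c ∈ F → (hc : c ∈ O) → residue O ⟨c, hc⟩ ∈ L) :
    H.FiniteIndex ∧ Module.Finite L (ResidueField O) ∧
      H.index * Module.finrank L (ResidueField O) ≤ Module.finrank F K := by
  classical
  -- coset families and residue-independent families are bounded
  have key : ∀ (e : ℕ) (c : Fin e → (ValuationSubring.ValueGroup O)ˣ ⧸ H), Function.Injective c →
      ∀ (f : ℕ) (r : Fin f → ResidueField O), LinearIndependent L r →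
      e * f ≤ Module.finrank F K := by
    intro e c hc f r hr
    choose a ha using fun i =>
      O.valuation_surjective (((c i).out : (ValuationSubring.ValueGroup O)ˣ) :
        ValuationSubring.ValueGroup O)
    have ha0 : ∀ i, a i ≠ 0 := fun i h => by
      have h1 := ha i
      rw [h, map_zero] at h1
      exact (c i).out.ne_zero h1.symm
    have hmk : ∀ i, Units.mk0 (O.valuation (a i)) ((Valuation.ne_zero_iff _).mpr (ha0 i)) =
        (c i).out := fun i => Units.ext (ha i)
    choose b hb using fun j => IsLocalRing.residue_surjective (r j)
    have hb' : LinearIndependent L fun j => residue O (b j) := by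
      have heq : (fun j => residue O (b j)) = r := funext hb
      rw [heq]
      exact hr
    refine mul_le_finrank_of_valuation_of_residue O F H hH L hL a ha0 (fun i i' hii' hmem =>
      hii' (hc ?_)) b hb'
    rw [hmk, hmk] at hmem
    rw [← QuotientGroup.out_eq' (c i), ← QuotientGroup.out_eq' (c i')]
    exact QuotientGroup.eq.mpr hmem
  -- finiteness of the index
  have hfinQ : Finite ((ValuationSubring.ValueGroup O)ˣ ⧸ H) := by
    by_contra hinf
    rw [not_finite_iff_infinite] at hinf
    obtain ⟨s, hs⟩ := Infinite.exists_subset_card_eq ((ValuationSubring.ValueGroup O)ˣ ⧸ H)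
      (Module.finrank F K + 1)
    have h := key (Module.finrank F K + 1)
      (fun i => ((s.equivFin.symm (Fin.cast hs.symm i) : ↥s) : _ ⧸ H))
      (Subtype.val_injective.comp (s.equivFin.symm.injective.comp (Fin.cast_injective _)))
      1 (fun _ => 1) (linearIndependent_unique_iff.mpr one_ne_zero)
    omega
  haveI := hfinQ
  haveI hfi : H.FiniteIndex := Subgroup.finiteIndex_of_finite_quotient
  haveI := Fintype.ofFinite ((ValuationSubring.ValueGroup O)ˣ ⧸ H)
  have hidx : H.index = Fintype.card ((ValuationSubring.ValueGroup O)ˣ ⧸ H) := by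
    rw [Subgroup.index, Nat.card_eq_fintype_card]
  have hidx1 : 1 ≤ H.index := Nat.one_le_iff_ne_zero.mpr Subgroup.FiniteIndex.index_ne_zero
  -- finiteness of the residue extension
  have hrank : Module.rank L (ResidueField O) ≤ Module.finrank F K := by
    refine rank_le fun t ht => ?_
    have h := key 1 (fun _ => (1 : (ValuationSubring.ValueGroup O)ˣ ⧸ H))
      (Function.injective_of_subsingleton _) t.card (fun i => ((t.equivFin.symm i : ↥t) : _))
      (ht.comp _ t.equivFin.symm.injective)
    simpa using h
  have hfinL : Module.Finite L (ResidueField O) := by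
    rw [← Module.rank_lt_aleph0_iff]
    exact hrank.trans_lt (Cardinal.natCast_lt_aleph0)
  refine ⟨hfi, hfinL, ?_⟩
  haveI := hfinL
  let bL := Module.finBasis L (ResidueField O)
  have h := key _ (fun i => (Fintype.equivFin _).symm i) (Equiv.injective _) _ bL bL.linearIndependent
  rwa [← hidx] at h

end Literature.AlgebraicGeometry.Resolution
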